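import Literature.MathematicalPhysics.QuantumManyBody.BoseGasThermodynamicLimitRuelle
import Literature.MathematicalPhysics.QuantumManyBody.SwapPurity
import Mathlib.GroupTheory.Perm.Fin
import HarnessLib

/-!
# Occupations are superadditive under Ruelle's merge of Dirichlet states

Topic `Literature/MathematicalPhysics/QuantumManyBody`, a companion of the `Merge` section of
`BoseGasThermodynamicLimitRuelle.lean` (`SupportedState.merge`: the normalised symmetrised product
`Ψ = K^{-1/2} ∑_σ (Ψ₁ ⊗ Ψ₂)(X ∘ σ)` of two bosonic `C¹` states `Ψ₁`, `Ψ₂` of `N₁`, `N₂` particles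
supported in DISJOINT regions `U₁`, `U₂ ⊆ ℝ³`, Ruelle 1969 §3.5.11) and of the one-particle
occupation `occupation N φ Ψ = ⟨φ, γ_Ψ φ⟩ = N ∫ |∫ conj φ(x) Ψ(x, Y) dx|² dY` of
`BoseEinsteinCondensation.lean` (LSSY 2005 §1.2 (1.17)).

## Content (all proved)

* `blockPermCard_eq_factorial`: the number of block-preserving relabellings of
  `BoseGasThermodynamicLimitRuelle.lean` is `N₁! N₂!` (left uncomputed there).
* `not_permAdm_of_block`: a configuration whose second block sits in `U₂` and whose first block has
  a particle outside `U₁` admits no admissible relabelling (pigeonhole on the first block).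
* `merge_vecCons_cast`: the slice structure of the merged state. If `Y ∈ (ℝ³)^{n+N₂}` has its first
  `n` particles in `U₁` and its last `N₂` in `U₂`, then for EVERY `x ∈ ℝ³`
  `Ψ(x, Y) = K^{-1/2} K₀ Ψ₁(x, Y_{≤ n}) Ψ₂(Y_{> n})` (`K₀ = blockPermCard (n+1) N₂`): for `x ∈ U₁`
  the identity relabelling is admissible and all admissible terms coincide
  (`symSum_eq_of_permAdm`), for `x ∉ U₁` both sides vanish.
* `occupation_le_occupation_merge` (**the result**): for every a.e.-strongly measurable mode `φ`,
  `⟨φ, γ_{Ψ₁} φ⟩ ≤ ⟨φ, γ_{Ψ₁.merge Ψ₂} φ⟩`.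
  In fact `γ_{merge} = γ_{Ψ₁} ⊕ γ_{Ψ₂}`; only the lower bound by the first summand is proved here
  (the configurations `Y` carrying `N₁` particles in `U₁` contribute the non-negative `Ψ₂`-term,
  which is dropped). Proof: write `⟨φ, γ_Ψ φ⟩ = (n+N₂+1) ∫ F(Y) dY`,
  `F(Y) = |∫ conj φ(x) Ψ(x,Y) dx|²`, and compare `F` pointwise with the relabelling average
  `∑_{τ ∈ S_{n+N₂}} G(Y ∘ τ)`, `G(Y') = K^{-1} K₀² |∫ conj φ(x) Ψ₁(x, Y'_{≤ n}) dx|² |Ψ₂(Y'_{> n})|²`: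
  `G(Y ∘ τ) ≠ 0` forces `τ` to be admissible at `Y` (for the blocks `n`, `N₂`), all admissible `τ`
  give `G(Y ∘ τ) = F(Y)` by the slice structure and Bose symmetry, and there are
  `blockPermCard n N₂` of them (`sum_eq_card_mul_of_permAdm`); integrating (Lebesgue measure is
  relabelling invariant, Tonelli along `(ℝ³)^n × (ℝ³)^{N₂}`) gives
  `(n+N₂)! K^{-1} K₀² ⟨φ,γ_{Ψ₁}φ⟩/(n+1) ≤ blockPermCard n N₂ · ∫ F`, and the constants cancel by
  `K = K₀ (n+1+N₂)!`, `K₀ = (n+1)! N₂!`, `blockPermCard n N₂ = n! N₂!`. The inner Bochner integrals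
  need no integrability (`∫ c f = c ∫ f` holds for the junk value too); the mode is replaced by a
  strongly measurable modification first (`occupation_congr_ae`).

## Design

No new definitions: the reindexing `(ℝ³)^{n+1+N₂} ≃ (ℝ³)^{(n+N₂)+1}` needed to expose the first
particle of the merged state is the value-preserving `Fin.cast`, transported through `occupation`
and through Bose symmetry by `subst` (`occupation_cast`, `symm_cast`); the lift of a relabelling of
the last `n + N₂` particles is Mathlib's `Equiv.Perm.decomposeFin.symm (0, τ)`.

Sources: D. Ruelle, *Statistical Mechanics: Rigorous Results* (1969), §3.5.11 (the merge);
LSSY 2005, §1.2 (1.17) (the one-particle density matrix). The superadditivity statement itself is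
the elementary block structure of the one-particle density matrix of a symmetrised product with
disjoint supports; we know no printed reference and tag it folklore.

Deliberately NOT here: the equality `γ_{merge} = γ₁ ⊕ γ₂` (the `Ψ₂`-summand), modes that are not
functions (`γ` as an operator), overlapping supports.
-/

noncomputable section

open MeasureTheory Filter
open scoped ENNReal NNReal ComplexConjugate

namespace Literature.MathematicalPhysics.QuantumManyBody.BoseGas

/-! ### The number of block-preserving relabellings -/

section BlockPermCard

variable {N₁ N₂ : ℕ}

/-- The relabelling assembled from `τ₁ ∈ S_{N₁}`, `τ₂ ∈ S_{N₂}` acts on the first block through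
`τ₁`. [folklore] -/
theorem permCongr_sumCongr_castAdd (τ₁ : Equiv.Perm (Fin N₁)) (τ₂ : Equiv.Perm (Fin N₂))
    (i : Fin N₁) :
    finSumFinEquiv.permCongr (τ₁.sumCongr τ₂) (Fin.castAdd N₂ i) = Fin.castAdd N₂ (τ₁ i) := by
  simp [Equiv.permCongr_apply]

/-- The relabelling assembled from `τ₁ ∈ S_{N₁}`, `τ₂ ∈ S_{N₂}` acts on the second block through
`τ₂`. [folklore] -/
theorem permCongr_sumCongr_natAdd (τ₁ : Equiv.Perm (Fin N₁)) (τ₂ : Equiv.Perm (Fin N₂))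
    (j : Fin N₂) :
    finSumFinEquiv.permCongr (τ₁.sumCongr τ₂) (Fin.natAdd N₁ j) = Fin.natAdd N₁ (τ₂ j) := by
  simp [Equiv.permCongr_apply]

/-- **`blockPermCard N₁ N₂ = N₁! · N₂!`**: the block-preserving relabellings are the Young subgroup
`S_{N₁} × S_{N₂}`. [folklore] -/
theorem blockPermCard_eq_factorial (N₁ N₂ : ℕ) :
    blockPermCard N₁ N₂ = N₁.factorial * N₂.factorial := by
  let Φ : Equiv.Perm (Fin N₁) × Equiv.Perm (Fin N₂) → Equiv.Perm (Fin (N₁ + N₂)) :=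
    fun p => finSumFinEquiv.permCongr (p.1.sumCongr p.2)
  have hΦ₁ : ∀ (p : Equiv.Perm (Fin N₁) × Equiv.Perm (Fin N₂)) (i : Fin N₁),
      Φ p (Fin.castAdd N₂ i) = Fin.castAdd N₂ (p.1 i) :=
    fun p i => permCongr_sumCongr_castAdd p.1 p.2 i
  have hΦ₂ : ∀ (p : Equiv.Perm (Fin N₁) × Equiv.Perm (Fin N₂)) (j : Fin N₂),
      Φ p (Fin.natAdd N₁ j) = Fin.natAdd N₁ (p.2 j) :=
    fun p j => permCongr_sumCongr_natAdd p.1 p.2 j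
  have hinj : Function.Injective Φ := by
    intro p q hpq
    refine Prod.ext (Equiv.ext fun i => Fin.castAdd_injective N₁ N₂ ?_)
      (Equiv.ext fun j => Fin.natAdd_injective N₂ N₁ ?_)
    · rw [← hΦ₁ p i, ← hΦ₁ q i, hpq]
    · rw [← hΦ₂ p j, ← hΦ₂ q j, hpq]
  have hcard : (Finset.univ.image Φ).card = N₁.factorial * N₂.factorial := by
    rw [Finset.card_image_of_injective _ hinj, Finset.card_univ, Fintype.card_prod,
      Fintype.card_perm, Fintype.card_perm, Fintype.card_fin, Fintype.card_fin]
  rw [← hcard]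
  unfold blockPermCard
  congr 1
  ext π
  simp only [Finset.mem_filter, Finset.mem_univ, true_and, Finset.mem_image]
  constructor
  · intro hπ
    obtain ⟨τ₁, hτ₁⟩ := exists_perm_of_maps_block (Fin.castAdd_injective _ _) π hπ
    obtain ⟨τ₂, hτ₂⟩ := exists_perm_of_maps_block (Fin.natAdd_injective _ _) π hπ.natAdd
    refine ⟨(τ₁, τ₂), Equiv.ext fun k => ?_⟩
    rcases exists_eq_castAdd_or k with ⟨i, rfl⟩ | ⟨j, rfl⟩
    · rw [hτ₁, hΦ₁]
    · rw [hτ₂, hΦ₂]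
  · rintro ⟨p, rfl⟩
    exact fun i => ⟨p.1 i, hΦ₁ p i⟩

/-- `blockPermCard (n+1) N₂ = (n+1) · blockPermCard n N₂`, in `ℝ≥0∞`. [folklore] -/
theorem cast_blockPermCard_succ (n N₂ : ℕ) :
    (blockPermCard (n + 1) N₂ : ℝ≥0∞) = ((n : ℝ≥0∞) + 1) * blockPermCard n N₂ := by
  rw [blockPermCard_eq_factorial, blockPermCard_eq_factorial, Nat.factorial_succ]
  push_cast
  ring

end BlockPermCard

/-! ### Transport of `occupation` and of Bose symmetry along `Fin.cast` -/

section Transfer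

/-- The occupation only depends on the mode up to a Lebesgue-null modification (the inner Bochner
integrals agree for every `Y`). [folklore] -/
theorem occupation_congr_ae {N : ℕ} {φ φ' : Space → ℂ} (hφ : φ =ᵐ[volume] φ')
    (Ψ : Config N → ℂ) : occupation N φ Ψ = occupation N φ' Ψ := by
  cases N with
  | zero => rfl
  | succ n =>
    have hY : ∀ Y : Config n, (∫ x, conj (φ x) * Ψ (Matrix.vecCons x Y)) =
        ∫ x, conj (φ' x) * Ψ (Matrix.vecCons x Y) := fun Y =>
      integral_congr_ae (hφ.mono fun x hx => by simp only [hx])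
    show (n + 1 : ℝ≥0∞) * ∫⁻ Y : Config n,
        (‖∫ x, conj (φ x) * Ψ (Matrix.vecCons x Y)‖₊ : ℝ≥0∞) ^ 2 =
      (n + 1 : ℝ≥0∞) * ∫⁻ Y : Config n,
        (‖∫ x, conj (φ' x) * Ψ (Matrix.vecCons x Y)‖₊ : ℝ≥0∞) ^ 2
    simp_rw [hY]

/-- Reindexing the particles along `Fin.cast` does not change the occupation (by `subst`).
[folklore] -/
theorem occupation_cast {N m : ℕ} (h : N = m + 1) (φ : Space → ℂ) (Ψ : Config N → ℂ) :
    occupation N φ Ψ = occupation (m + 1) φ (fun Z => Ψ (fun k => Z (Fin.cast h k))) := by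
  subst h
  rfl

/-- A Bose-symmetric function stays symmetric after reindexing along `Fin.cast` (by `subst`).
[folklore] -/
theorem symm_cast {N M : ℕ} (h : N = M) {Ψ : Config N → ℂ}
    (hΨ : ∀ (σ : Equiv.Perm (Fin N)) (X : Config N), Ψ (X ∘ ⇑σ) = Ψ X)
    (π : Equiv.Perm (Fin M)) (Z : Config M) :
    Ψ (fun k => (Z ∘ ⇑π) (Fin.cast h k)) = Ψ (fun k => Z (Fin.cast h k)) := by
  subst h
  exact hΨ π Z

/-- Restricting a configuration along a map of labels is measurable. [folklore] -/
theorem measurable_comp_labels {M N : ℕ} {F : Config M → ℝ≥0∞} (hF : Measurable F)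
    (f : Fin M → Fin N) : Measurable fun Y : Config N => F (Y ∘ f) :=
  hF.comp (measurable_pi_lambda _ fun i => measurable_pi_apply (f i))

variable {n N₂ : ℕ}

/-- First particle of `(x, Y)` read through the cast `Fin (n+1+N₂) → Fin (n+N₂+1)`. [folklore] -/
theorem vecCons_cast_castAdd_zero (h : n + 1 + N₂ = n + N₂ + 1) (x : Space) (Y : Config (n + N₂)) :
    Matrix.vecCons x Y (Fin.cast h (Fin.castAdd N₂ (0 : Fin (n + 1)))) = x := by
  have : Fin.cast h (Fin.castAdd N₂ (0 : Fin (n + 1))) = 0 := Fin.ext (by simp)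
  rw [this, Matrix.cons_val_zero]

/-- Particles `1, …, n` of `(x, Y)` read through the cast are `Y_{< n}`. [folklore] -/
theorem vecCons_cast_castAdd_succ (h : n + 1 + N₂ = n + N₂ + 1) (x : Space) (Y : Config (n + N₂))
    (i : Fin n) :
    Matrix.vecCons x Y (Fin.cast h (Fin.castAdd N₂ i.succ)) = Y (Fin.castAdd N₂ i) := by
  have : Fin.cast h (Fin.castAdd N₂ i.succ) = (Fin.castAdd N₂ i).succ := Fin.ext (by simp)
  rw [this, Matrix.cons_val_succ]

/-- The last `N₂` particles of `(x, Y)` read through the cast are `Y_{≥ n}`. [folklore] -/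
theorem vecCons_cast_natAdd (h : n + 1 + N₂ = n + N₂ + 1) (x : Space) (Y : Config (n + N₂))
    (j : Fin N₂) :
    Matrix.vecCons x Y (Fin.cast h (Fin.natAdd (n + 1) j)) = Y (Fin.natAdd n j) := by
  have : Fin.cast h (Fin.natAdd (n + 1) j) = (Fin.natAdd n j).succ :=
    Fin.ext (by simp only [Fin.val_cast, Fin.val_natAdd, Fin.val_succ]; omega)
  rw [this, Matrix.cons_val_succ]

/-- The first block of `(x, Y)` read through the cast is `(x, Y_{< n})`. [folklore] -/
theorem vecCons_cast_comp_castAdd (h : n + 1 + N₂ = n + N₂ + 1) (x : Space) (Y : Config (n + N₂)) :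
    (fun k : Fin (n + 1 + N₂) => Matrix.vecCons x Y (Fin.cast h k)) ∘ Fin.castAdd N₂ =
      Matrix.vecCons x (Y ∘ Fin.castAdd N₂) := by
  funext i
  rcases Fin.eq_zero_or_eq_succ i with rfl | ⟨i, rfl⟩
  · simp only [Function.comp_apply, Matrix.cons_val_zero]
    exact vecCons_cast_castAdd_zero h x Y
  · simp only [Function.comp_apply, Matrix.cons_val_succ]
    exact vecCons_cast_castAdd_succ h x Y i

/-- The second block of `(x, Y)` read through the cast is `Y_{≥ n}`. [folklore] -/
theorem vecCons_cast_comp_natAdd (h : n + 1 + N₂ = n + N₂ + 1) (x : Space) (Y : Config (n + N₂)) :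
    (fun k : Fin (n + 1 + N₂) => Matrix.vecCons x Y (Fin.cast h k)) ∘ Fin.natAdd (n + 1) =
      Y ∘ Fin.natAdd n := by
  funext j
  simp only [Function.comp_apply]
  exact vecCons_cast_natAdd h x Y j

/-- Relabelling the tail: `(x, Y ∘ τ) = (x, Y) ∘ τ⁺` with `τ⁺` the lift of `τ` fixing the first
particle (Mathlib's `Equiv.Perm.decomposeFin.symm (0, τ)`). [folklore] -/
theorem vecCons_comp_perm {m : ℕ} (x : Space) (Y : Config m) (τ : Equiv.Perm (Fin m)) :
    (Matrix.vecCons x (Y ∘ ⇑τ) : Config (m + 1)) =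
      (Matrix.vecCons x Y : Config (m + 1)) ∘ ⇑(Equiv.Perm.decomposeFin.symm (0, τ)) := by
  funext k
  rcases Fin.eq_zero_or_eq_succ k with rfl | ⟨i, rfl⟩
  · simp
  · simp

/-- `Y ↦ |∫ conj φ(x) Ψ(x, Y) dx|²` is measurable for measurable `φ`, `Ψ` (Fubini). [folklore] -/
theorem measurable_ennnorm_integral_conj_mul_vecCons_sq {m : ℕ} {φ : Space → ℂ}
    (hφ : Measurable φ) {Ψ : Config (m + 1) → ℂ} (hΨ : Measurable Ψ) :
    Measurable fun Y : Config m =>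
      (‖∫ x, conj (φ x) * Ψ (Matrix.vecCons x Y)‖₊ : ℝ≥0∞) ^ 2 := by
  have hf : StronglyMeasurable
      (Function.uncurry fun (Y : Config m) (x : Space) => conj (φ x) * Ψ (Matrix.vecCons x Y)) := by
    refine Measurable.stronglyMeasurable ?_
    show Measurable fun p : Config m × Space => conj (φ p.2) * Ψ (Matrix.vecCons p.2 p.1)
    exact ((Complex.continuous_conj.measurable.comp hφ).comp measurable_snd).mul
      (hΨ.comp (measurable_vecCons.comp (measurable_snd.prodMk measurable_fst)))
  exact ((hf.integral_prod_right' (ν := (volume : Measure Space))).measurable.nnnorm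
    |>.coe_nnreal_ennreal).pow_const 2

end Transfer

/-! ### Slices of the merged state -/

section Merge

variable {N₁ N₂ n : ℕ} {U₁ U₂ : Set Space}

/-- **Pigeonhole on the first block.** If the second block of `W` sits in `U₂` and some particle of
the first block is outside `U₁`, no relabelling is admissible at `W` (an admissible `σ` would map
the first block into itself, bijectively, onto particles in `U₁`). [folklore] -/
theorem not_permAdm_of_block (hdisj : Disjoint U₁ U₂) {W : Config (N₁ + N₂)}
    (h₂ : ∀ j, W (Fin.natAdd N₁ j) ∈ U₂) {i₀ : Fin N₁} (h₁ : W (Fin.castAdd N₂ i₀) ∉ U₁)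
    (σ : Equiv.Perm (Fin (N₁ + N₂))) : ¬ PermAdm N₁ N₂ U₁ U₂ σ W := by
  intro hσ
  have hblock : ∀ i : Fin N₁, ∃ i' : Fin N₁, σ (Fin.castAdd N₂ i) = Fin.castAdd N₂ i' := by
    intro i
    rcases exists_eq_castAdd_or (σ (Fin.castAdd N₂ i)) with ⟨i', hi'⟩ | ⟨j, hj⟩
    · exact ⟨i', hi'⟩
    · have hU₁ := hσ.1 i
      rw [hj] at hU₁
      exact absurd (h₂ j) (Set.disjoint_left.1 hdisj hU₁)
  obtain ⟨τ, hτ⟩ := exists_perm_of_maps_block (Fin.castAdd_injective _ _) σ hblock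
  have := hσ.1 (τ.symm i₀)
  rw [hτ, Equiv.apply_symm_apply] at this
  exact h₁ this

variable (hdisj : Disjoint U₁ U₂) (Ψ₁ : SupportedState (n + 1) U₁) (Ψ₂ : SupportedState N₂ U₂)

/-- **Slices of the merged state.** If `Y ∈ (ℝ³)^{n+N₂}` has its first `n` particles in `U₁` and
its last `N₂` in `U₂`, then for every `x`,
`(Ψ₁.merge Ψ₂)(x, Y) = K^{-1/2} · blockPermCard (n+1) N₂ · Ψ₁(x, Y_{< n}) · Ψ₂(Y_{≥ n})`
(the merged state read through the cast `Fin (n+1+N₂) → Fin (n+N₂+1)`): for `x ∈ U₁` the identity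
relabelling is admissible (`symSum_eq_of_permAdm`), for `x ∉ U₁` both sides vanish
(`not_permAdm_of_block`). [cite: Ruelle1969, §3.5.11] -/
theorem merge_vecCons_cast (h : n + 1 + N₂ = n + N₂ + 1) {Y : Config (n + N₂)}
    (hY₁ : ∀ i, Y (Fin.castAdd N₂ i) ∈ U₁) (hY₂ : ∀ j, Y (Fin.natAdd n j) ∈ U₂) (x : Space) :
    (Ψ₁.merge Ψ₂ hdisj).ψ (fun k => Matrix.vecCons x Y (Fin.cast h k)) =
      ((mergeScale (n + 1) N₂ : ℝ) : ℂ) * (blockPermCard (n + 1) N₂ : ℂ) *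
        (Ψ₁.ψ (Matrix.vecCons x (Y ∘ Fin.castAdd N₂)) * Ψ₂.ψ (Y ∘ Fin.natAdd n)) := by
  show ((mergeScale (n + 1) N₂ : ℝ) : ℂ) *
      symSum Ψ₁ Ψ₂ (fun k => Matrix.vecCons x Y (Fin.cast h k)) = _
  by_cases hx : x ∈ U₁
  · have hadm : PermAdm (n + 1) N₂ U₁ U₂ 1 (fun k => Matrix.vecCons x Y (Fin.cast h k)) := by
      refine ⟨fun i => ?_, fun j => ?_⟩
      · simp only [Equiv.Perm.coe_one, id_eq]
        rcases Fin.eq_zero_or_eq_succ i with rfl | ⟨i, rfl⟩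
        · rw [vecCons_cast_castAdd_zero]
          exact hx
        · rw [vecCons_cast_castAdd_succ]
          exact hY₁ i
      · simp only [Equiv.Perm.coe_one, id_eq]
        rw [vecCons_cast_natAdd]
        exact hY₂ j
    rw [symSum_eq_of_permAdm Ψ₁ Ψ₂ hdisj hadm, permProd, Equiv.Perm.coe_one, Function.comp_id,
      prodFun_eq, vecCons_cast_comp_castAdd, vecCons_cast_comp_natAdd]
    ring
  · have h0 : Ψ₁.ψ (Matrix.vecCons x (Y ∘ Fin.castAdd N₂)) = 0 :=
      Ψ₁.eq_zero _ ⟨0, by simpa using hx⟩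
    have hout : Matrix.vecCons x Y (Fin.cast h (Fin.castAdd N₂ (0 : Fin (n + 1)))) ∉ U₁ := by
      rw [vecCons_cast_castAdd_zero]
      exact hx
    have hin : ∀ j, Matrix.vecCons x Y (Fin.cast h (Fin.natAdd (n + 1) j)) ∈ U₂ := fun j => by
      rw [vecCons_cast_natAdd]
      exact hY₂ j
    have hno : ∀ σ, ¬ PermAdm (n + 1) N₂ U₁ U₂ σ (fun k => Matrix.vecCons x Y (Fin.cast h k)) :=
      not_permAdm_of_block hdisj hin hout
    rw [h0, zero_mul, mul_zero, symSum,
      Finset.sum_eq_zero fun σ _ => (permProd_eq_zero_of_not_permAdm Ψ₁ Ψ₂ (hno σ)).1, mul_zero]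

/-- Relabelling the last `n + N₂` particles does not change the merged state (Bose symmetry,
through the cast). [folklore] -/
theorem merge_vecCons_cast_comp_perm (h : n + 1 + N₂ = n + N₂ + 1) (Y : Config (n + N₂))
    (τ : Equiv.Perm (Fin (n + N₂))) (x : Space) :
    (Ψ₁.merge Ψ₂ hdisj).ψ (fun k => Matrix.vecCons x (Y ∘ ⇑τ) (Fin.cast h k)) =
      (Ψ₁.merge Ψ₂ hdisj).ψ (fun k => Matrix.vecCons x Y (Fin.cast h k)) := by
  rw [vecCons_comp_perm x Y τ]
  exact symm_cast h (Ψ₁.merge Ψ₂ hdisj).symm _ _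

/-- **Pointwise comparison.** For every `Y ∈ (ℝ³)^{n+N₂}`, the relabelling sum
`∑_τ K^{-1} K₀² |∫ conj φ(x) Ψ₁(x, (Y∘τ)_{< n}) dx|² |Ψ₂((Y∘τ)_{≥ n})|²` is at most
`blockPermCard n N₂ · |∫ conj φ(x) (Ψ₁.merge Ψ₂)(x, Y) dx|²`: a non-zero term forces `τ` to be
admissible at `Y`, every admissible term equals the right-hand slice square
(`merge_vecCons_cast`, `∫ c f = c ∫ f` without integrability), and there are `blockPermCard n N₂`
admissible `τ` (`sum_eq_card_mul_of_permAdm`). [folklore] -/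
theorem sum_perm_sliceSq_le_slice_merge (h : n + 1 + N₂ = n + N₂ + 1) (φ : Space → ℂ)
    (Y : Config (n + N₂)) :
    ∑ τ : Equiv.Perm (Fin (n + N₂)),
        (mergeScale (n + 1) N₂ : ℝ≥0∞) ^ 2 * (blockPermCard (n + 1) N₂ : ℝ≥0∞) ^ 2 *
          ((‖∫ x, conj (φ x) * Ψ₁.ψ (Matrix.vecCons x ((Y ∘ ⇑τ) ∘ Fin.castAdd N₂))‖₊ : ℝ≥0∞) ^ 2 *
            (‖Ψ₂.ψ ((Y ∘ ⇑τ) ∘ Fin.natAdd n)‖₊ : ℝ≥0∞) ^ 2) ≤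
      (blockPermCard n N₂ : ℝ≥0∞) *
        (‖∫ x, conj (φ x) *
            (Ψ₁.merge Ψ₂ hdisj).ψ (fun k => Matrix.vecCons x Y (Fin.cast h k))‖₊ : ℝ≥0∞) ^ 2 := by
  -- terms that are not admissible at `Y` vanish
  have hvan : ∀ τ : Equiv.Perm (Fin (n + N₂)), ¬ PermAdm n N₂ U₁ U₂ τ Y →
      (mergeScale (n + 1) N₂ : ℝ≥0∞) ^ 2 * (blockPermCard (n + 1) N₂ : ℝ≥0∞) ^ 2 *
          ((‖∫ x, conj (φ x) * Ψ₁.ψ (Matrix.vecCons x ((Y ∘ ⇑τ) ∘ Fin.castAdd N₂))‖₊ : ℝ≥0∞) ^ 2 *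
            (‖Ψ₂.ψ ((Y ∘ ⇑τ) ∘ Fin.natAdd n)‖₊ : ℝ≥0∞) ^ 2) = 0 := by
    intro τ hτ
    simp only [PermAdm, not_and_or, not_forall] at hτ
    rcases hτ with ⟨i, hi⟩ | ⟨j, hj⟩
    · have h0 : ∀ x, Ψ₁.ψ (Matrix.vecCons x ((Y ∘ ⇑τ) ∘ Fin.castAdd N₂)) = 0 := fun x =>
        Ψ₁.eq_zero _ ⟨i.succ, by simpa using hi⟩
      simp [h0]
    · have h0 : Ψ₂.ψ ((Y ∘ ⇑τ) ∘ Fin.natAdd n) = 0 := Ψ₂.eq_zero _ ⟨j, hj⟩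
      simp [h0]
  -- admissible terms equal the slice square of the merged state
  have hval : ∀ τ : Equiv.Perm (Fin (n + N₂)), PermAdm n N₂ U₁ U₂ τ Y →
      (mergeScale (n + 1) N₂ : ℝ≥0∞) ^ 2 * (blockPermCard (n + 1) N₂ : ℝ≥0∞) ^ 2 *
          ((‖∫ x, conj (φ x) * Ψ₁.ψ (Matrix.vecCons x ((Y ∘ ⇑τ) ∘ Fin.castAdd N₂))‖₊ : ℝ≥0∞) ^ 2 *
            (‖Ψ₂.ψ ((Y ∘ ⇑τ) ∘ Fin.natAdd n)‖₊ : ℝ≥0∞) ^ 2) =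
        (‖∫ x, conj (φ x) *
            (Ψ₁.merge Ψ₂ hdisj).ψ (fun k => Matrix.vecCons x Y (Fin.cast h k))‖₊ : ℝ≥0∞) ^ 2 := by
    intro τ hτ
    have hint : (fun x => conj (φ x) *
        (Ψ₁.merge Ψ₂ hdisj).ψ (fun k => Matrix.vecCons x Y (Fin.cast h k))) = fun x =>
        (((mergeScale (n + 1) N₂ : ℝ) : ℂ) * (blockPermCard (n + 1) N₂ : ℂ) *
            Ψ₂.ψ ((Y ∘ ⇑τ) ∘ Fin.natAdd n)) *
          (conj (φ x) * Ψ₁.ψ (Matrix.vecCons x ((Y ∘ ⇑τ) ∘ Fin.castAdd N₂))) := by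
      funext x
      rw [← merge_vecCons_cast_comp_perm hdisj Ψ₁ Ψ₂ h Y τ x,
        merge_vecCons_cast hdisj Ψ₁ Ψ₂ h (Y := Y ∘ ⇑τ) hτ.1 hτ.2 x]
      ring
    rw [hint, integral_const_mul]
    simp only [ennnorm_mul_sq, ennnorm_mergeScale_sq, ennnorm_natCast]
    ring
  by_cases hex : ∃ τ₀, PermAdm n N₂ U₁ U₂ τ₀ Y
  · obtain ⟨τ₀, hτ₀⟩ := hex
    have key := sum_eq_card_mul_of_permAdm hdisj hτ₀ _
      (fun τ hτ => (hval τ hτ).trans (hval τ₀ hτ₀).symm) hvan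
    exact le_of_eq (by rw [key, nsmul_eq_mul, hval τ₀ hτ₀])
  · rw [not_exists] at hex
    rw [Finset.sum_eq_zero fun τ _ => hvan τ (hex τ)]
    exact zero_le

/-- **Superadditivity of occupations under merging, `N₁ = n + 1`, measurable mode.**
`⟨φ, γ_{Ψ₁} φ⟩ ≤ ⟨φ, γ_{Ψ₁.merge Ψ₂} φ⟩`: integrate `sum_perm_sliceSq_le_slice_merge` (relabelling
invariance of Lebesgue measure, Tonelli along `(ℝ³)^n × (ℝ³)^{N₂}`, `∫ |Ψ₂|² = 1`) and cancel the
constants with `mergeScale_sq_mul` and `blockPermCard_eq_factorial`. [folklore] -/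
theorem occupation_le_occupation_merge_succ {φ : Space → ℂ} (hφ : Measurable φ) :
    occupation (n + 1) φ Ψ₁.ψ ≤ occupation (n + 1 + N₂) φ (Ψ₁.merge Ψ₂ hdisj).ψ := by
  have h : n + 1 + N₂ = n + N₂ + 1 := Nat.add_right_comm n 1 N₂
  -- measurability of the two block factors
  have mA : Measurable fun Y₁ : Config n =>
      (‖∫ x, conj (φ x) * Ψ₁.ψ (Matrix.vecCons x Y₁)‖₊ : ℝ≥0∞) ^ 2 :=
    measurable_ennnorm_integral_conj_mul_vecCons_sq hφ Ψ₁.contDiff.continuous.measurable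
  have mB : Measurable fun Y₂ : Config N₂ => (‖Ψ₂.ψ Y₂‖₊ : ℝ≥0∞) ^ 2 :=
    measurable_ennnormSq Ψ₂.contDiff.continuous
  have hc : (mergeScale (n + 1) N₂ : ℝ≥0∞) ^ 2 * (blockPermCard (n + 1) N₂ : ℝ≥0∞) ^ 2 ≠ ⊤ :=
    ENNReal.mul_ne_top (ENNReal.pow_ne_top ENNReal.coe_ne_top)
      (ENNReal.pow_ne_top (ENNReal.natCast_ne_top _))
  -- each relabelled term integrates to the same block product
  have hterm : ∀ τ : Equiv.Perm (Fin (n + N₂)),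
      (∫⁻ Y : Config (n + N₂),
        (mergeScale (n + 1) N₂ : ℝ≥0∞) ^ 2 * (blockPermCard (n + 1) N₂ : ℝ≥0∞) ^ 2 *
          ((‖∫ x, conj (φ x) * Ψ₁.ψ (Matrix.vecCons x ((Y ∘ ⇑τ) ∘ Fin.castAdd N₂))‖₊ : ℝ≥0∞) ^ 2 *
            (‖Ψ₂.ψ ((Y ∘ ⇑τ) ∘ Fin.natAdd n)‖₊ : ℝ≥0∞) ^ 2)) =
      (mergeScale (n + 1) N₂ : ℝ≥0∞) ^ 2 * (blockPermCard (n + 1) N₂ : ℝ≥0∞) ^ 2 *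
        ∫⁻ Y₁ : Config n, (‖∫ x, conj (φ x) * Ψ₁.ψ (Matrix.vecCons x Y₁)‖₊ : ℝ≥0∞) ^ 2 := by
    intro τ
    rw [lintegral_comp_perm τ (fun Y' : Config (n + N₂) =>
        (mergeScale (n + 1) N₂ : ℝ≥0∞) ^ 2 * (blockPermCard (n + 1) N₂ : ℝ≥0∞) ^ 2 *
          ((‖∫ x, conj (φ x) * Ψ₁.ψ (Matrix.vecCons x (Y' ∘ Fin.castAdd N₂))‖₊ : ℝ≥0∞) ^ 2 *
            (‖Ψ₂.ψ (Y' ∘ Fin.natAdd n)‖₊ : ℝ≥0∞) ^ 2)),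
      lintegral_const_mul' _ _ hc, lintegral_blocks_mul mA mB, Ψ₂.norm_eq, mul_one]
  -- integrate the pointwise comparison
  have stepB : (((n + N₂).factorial : ℕ) : ℝ≥0∞) *
      ((mergeScale (n + 1) N₂ : ℝ≥0∞) ^ 2 * (blockPermCard (n + 1) N₂ : ℝ≥0∞) ^ 2 *
        ∫⁻ Y₁ : Config n, (‖∫ x, conj (φ x) * Ψ₁.ψ (Matrix.vecCons x Y₁)‖₊ : ℝ≥0∞) ^ 2) ≤
      (blockPermCard n N₂ : ℝ≥0∞) * ∫⁻ Y : Config (n + N₂), (‖∫ x, conj (φ x) *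
        (Ψ₁.merge Ψ₂ hdisj).ψ (fun k => Matrix.vecCons x Y (Fin.cast h k))‖₊ : ℝ≥0∞) ^ 2 := by
    calc (((n + N₂).factorial : ℕ) : ℝ≥0∞) *
        ((mergeScale (n + 1) N₂ : ℝ≥0∞) ^ 2 * (blockPermCard (n + 1) N₂ : ℝ≥0∞) ^ 2 *
          ∫⁻ Y₁ : Config n, (‖∫ x, conj (φ x) * Ψ₁.ψ (Matrix.vecCons x Y₁)‖₊ : ℝ≥0∞) ^ 2)
        = ∑ τ : Equiv.Perm (Fin (n + N₂)), ∫⁻ Y : Config (n + N₂),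
            (mergeScale (n + 1) N₂ : ℝ≥0∞) ^ 2 * (blockPermCard (n + 1) N₂ : ℝ≥0∞) ^ 2 *
              ((‖∫ x, conj (φ x) *
                  Ψ₁.ψ (Matrix.vecCons x ((Y ∘ ⇑τ) ∘ Fin.castAdd N₂))‖₊ : ℝ≥0∞) ^ 2 *
                (‖Ψ₂.ψ ((Y ∘ ⇑τ) ∘ Fin.natAdd n)‖₊ : ℝ≥0∞) ^ 2) := by
          rw [Finset.sum_congr rfl fun τ _ => hterm τ, Finset.sum_const, Finset.card_univ,
            nsmul_eq_mul, Fintype.card_perm, Fintype.card_fin]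
      _ = ∫⁻ Y : Config (n + N₂), ∑ τ : Equiv.Perm (Fin (n + N₂)),
            (mergeScale (n + 1) N₂ : ℝ≥0∞) ^ 2 * (blockPermCard (n + 1) N₂ : ℝ≥0∞) ^ 2 *
              ((‖∫ x, conj (φ x) *
                  Ψ₁.ψ (Matrix.vecCons x ((Y ∘ ⇑τ) ∘ Fin.castAdd N₂))‖₊ : ℝ≥0∞) ^ 2 *
                (‖Ψ₂.ψ ((Y ∘ ⇑τ) ∘ Fin.natAdd n)‖₊ : ℝ≥0∞) ^ 2) := by
          refine (lintegral_finsetSum _ fun τ _ => ?_).symm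
          exact ((measurable_comp_labels mA (⇑τ ∘ Fin.castAdd N₂)).mul
            (measurable_comp_labels mB (⇑τ ∘ Fin.natAdd n))).const_mul _
      _ ≤ ∫⁻ Y : Config (n + N₂), (blockPermCard n N₂ : ℝ≥0∞) * (‖∫ x, conj (φ x) *
            (Ψ₁.merge Ψ₂ hdisj).ψ (fun k => Matrix.vecCons x Y (Fin.cast h k))‖₊ : ℝ≥0∞) ^ 2 :=
          lintegral_mono fun Y => sum_perm_sliceSq_le_slice_merge hdisj Ψ₁ Ψ₂ h φ Y
      _ = _ := lintegral_const_mul' _ _ (ENNReal.natCast_ne_top _)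
  -- the constants: `(n+N₂+1)! K^{-1} K₀² = K₀ = (n+1) · blockPermCard n N₂`
  have hsq : (mergeScale (n + 1) N₂ : ℝ≥0∞) ^ 2 *
      ((blockPermCard (n + 1) N₂ : ℝ≥0∞) * (((n + N₂ + 1).factorial : ℕ) : ℝ≥0∞)) = 1 := by
    have hm := mergeScale_sq_mul (N₁ := n + 1) (N₂ := N₂)
    rw [mergeConst, Fintype.card_perm, Fintype.card_fin, h] at hm
    exact hm
  have hconst : ((n + N₂ + 1 : ℕ) : ℝ≥0∞) * ((((n + N₂).factorial : ℕ) : ℝ≥0∞) *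
      ((mergeScale (n + 1) N₂ : ℝ≥0∞) ^ 2 * (blockPermCard (n + 1) N₂ : ℝ≥0∞) ^ 2)) =
      (blockPermCard (n + 1) N₂ : ℝ≥0∞) := by
    calc ((n + N₂ + 1 : ℕ) : ℝ≥0∞) * ((((n + N₂).factorial : ℕ) : ℝ≥0∞) *
          ((mergeScale (n + 1) N₂ : ℝ≥0∞) ^ 2 * (blockPermCard (n + 1) N₂ : ℝ≥0∞) ^ 2))
        = (mergeScale (n + 1) N₂ : ℝ≥0∞) ^ 2 * ((blockPermCard (n + 1) N₂ : ℝ≥0∞) *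
            (((n + N₂ + 1).factorial : ℕ) : ℝ≥0∞)) * (blockPermCard (n + 1) N₂ : ℝ≥0∞) := by
          rw [Nat.factorial_succ]
          push_cast
          ring
      _ = (blockPermCard (n + 1) N₂ : ℝ≥0∞) := by rw [hsq, one_mul]
  have hK := cast_blockPermCard_succ n N₂
  have hK₀0 : (blockPermCard n N₂ : ℝ≥0∞) ≠ 0 := Nat.cast_ne_zero.2 blockPermCard_pos.ne'
  have hK₀t : (blockPermCard n N₂ : ℝ≥0∞) ≠ ⊤ := ENNReal.natCast_ne_top _
  -- assemble
  rw [occupation_cast h φ (Ψ₁.merge Ψ₂ hdisj).ψ]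
  show ((n : ℝ≥0∞) + 1) *
      ∫⁻ Y₁ : Config n, (‖∫ x, conj (φ x) * Ψ₁.ψ (Matrix.vecCons x Y₁)‖₊ : ℝ≥0∞) ^ 2 ≤
    (((n + N₂ : ℕ) : ℝ≥0∞) + 1) * ∫⁻ Y : Config (n + N₂), (‖∫ x, conj (φ x) *
        (Ψ₁.merge Ψ₂ hdisj).ψ (fun k => Matrix.vecCons x Y (Fin.cast h k))‖₊ : ℝ≥0∞) ^ 2
  refine (ENNReal.mul_le_mul_iff_right hK₀0 hK₀t).1 ?_
  calc (blockPermCard n N₂ : ℝ≥0∞) * (((n : ℝ≥0∞) + 1) *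
        ∫⁻ Y₁ : Config n, (‖∫ x, conj (φ x) * Ψ₁.ψ (Matrix.vecCons x Y₁)‖₊ : ℝ≥0∞) ^ 2)
      = (blockPermCard (n + 1) N₂ : ℝ≥0∞) *
          ∫⁻ Y₁ : Config n, (‖∫ x, conj (φ x) * Ψ₁.ψ (Matrix.vecCons x Y₁)‖₊ : ℝ≥0∞) ^ 2 := by
        rw [hK]
        ring
    _ = ((n + N₂ + 1 : ℕ) : ℝ≥0∞) * ((((n + N₂).factorial : ℕ) : ℝ≥0∞) *
          ((mergeScale (n + 1) N₂ : ℝ≥0∞) ^ 2 * (blockPermCard (n + 1) N₂ : ℝ≥0∞) ^ 2)) *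
          ∫⁻ Y₁ : Config n, (‖∫ x, conj (φ x) * Ψ₁.ψ (Matrix.vecCons x Y₁)‖₊ : ℝ≥0∞) ^ 2 := by
        rw [hconst]
    _ = ((n + N₂ + 1 : ℕ) : ℝ≥0∞) * ((((n + N₂).factorial : ℕ) : ℝ≥0∞) *
          ((mergeScale (n + 1) N₂ : ℝ≥0∞) ^ 2 * (blockPermCard (n + 1) N₂ : ℝ≥0∞) ^ 2 *
            ∫⁻ Y₁ : Config n,
              (‖∫ x, conj (φ x) * Ψ₁.ψ (Matrix.vecCons x Y₁)‖₊ : ℝ≥0∞) ^ 2)) := by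
        ring
    _ ≤ ((n + N₂ + 1 : ℕ) : ℝ≥0∞) * ((blockPermCard n N₂ : ℝ≥0∞) *
          ∫⁻ Y : Config (n + N₂), (‖∫ x, conj (φ x) *
            (Ψ₁.merge Ψ₂ hdisj).ψ (fun k => Matrix.vecCons x Y (Fin.cast h k))‖₊ : ℝ≥0∞) ^ 2) :=
        mul_le_mul_right stepB _
    _ = (blockPermCard n N₂ : ℝ≥0∞) * ((((n + N₂ : ℕ) : ℝ≥0∞) + 1) *
          ∫⁻ Y : Config (n + N₂), (‖∫ x, conj (φ x) *
            (Ψ₁.merge Ψ₂ hdisj).ψ (fun k => Matrix.vecCons x Y (Fin.cast h k))‖₊ : ℝ≥0∞) ^ 2) := by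
        push_cast
        ring

end Merge

/-! ### The result -/

section Result

variable {N₁ N₂ : ℕ} {U₁ U₂ : Set Space}

/-- **Occupations are superadditive under Ruelle's merge.** For bosonic `C¹` states `Ψ₁`, `Ψ₂` of
`N₁`, `N₂` particles supported in disjoint regions `U₁`, `U₂ ⊆ ℝ³` and every a.e.-strongly
measurable mode `φ`, the occupation `⟨φ, γ φ⟩` of `φ` in the normalised symmetrised product
`Ψ₁.merge Ψ₂` is at least its occupation in `Ψ₁`:
`occupation N₁ φ Ψ₁ ≤ occupation (N₁ + N₂) φ (Ψ₁.merge Ψ₂)` (the one-particle density matrix of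
the merged state is `γ_{Ψ₁} ⊕ γ_{Ψ₂}`; Ruelle 1969 §3.5.11 for the merge, LSSY 2005 §1.2 (1.17) for
`γ`). No integrability of the mode is needed. [folklore] -/
theorem occupation_le_occupation_merge (hdisj : Disjoint U₁ U₂) (Ψ₁ : SupportedState N₁ U₁)
    (Ψ₂ : SupportedState N₂ U₂) {φ : Space → ℂ} (hφ : AEStronglyMeasurable φ volume) :
    occupation N₁ φ Ψ₁.ψ ≤ occupation (N₁ + N₂) φ (Ψ₁.merge Ψ₂ hdisj).ψ := by
  rw [occupation_congr_ae hφ.ae_eq_mk Ψ₁.ψ, occupation_congr_ae hφ.ae_eq_mk (Ψ₁.merge Ψ₂ hdisj).ψ]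
  cases N₁ with
  | zero => exact zero_le
  | succ n =>
    exact occupation_le_occupation_merge_succ hdisj Ψ₁ Ψ₂ hφ.stronglyMeasurable_mk.measurable

/-- The same with the measurability hypotheses on the regions that the crux line
`reward-pays-the-wall` carries (they are not needed). [folklore] -/
theorem occupation_le_occupation_merge' (hdisj : Disjoint U₁ U₂) (_hU₁ : MeasurableSet U₁)
    (_hU₂ : MeasurableSet U₂) (Ψ₁ : SupportedState N₁ U₁) (Ψ₂ : SupportedState N₂ U₂)
    (φ : Space → ℂ) (hφ : AEStronglyMeasurable φ volume) :
    occupation N₁ φ Ψ₁.ψ ≤ occupation (N₁ + N₂) φ (Ψ₁.merge Ψ₂ hdisj).ψ :=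
  occupation_le_occupation_merge hdisj Ψ₁ Ψ₂ hφ

end Result

end Literature.MathematicalPhysics.QuantumManyBody.BoseGas

end
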